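import Mathlib
import HarnessLib
import Summits.ValiantsHypothesis.ValiantsHypothesis.Theorems.LacunarySymmetroidMatrixDescartesProductPlusOneLetterVariance

/-!
# ValiantsHypothesis / LacunarySymmetroid — crux `MatrixDescartes` (stmt-ValiantsHypothesis-18050, V1),
# LINE (A) «product_plus_one»: SPLIT-SIGNED rows at an interior coupling, every `K` — the reduced row is MONOTONE

Every-`K` twin of ✓ `laurent_factor_strictAntiOn` (`…ProductPlusOneMiddleLaurent`, `K = 3`): for a row `f = Σ_l C a_l X^{d_l}` on ANY
support whose letters below the coupled exponent `d_{l₀}` are `≥ 0` and whose letters above it are `≤ 0` (SPLIT-SIGNED around `l₀`),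
the reduced row `k(x) = f(x)/x^{d_{l₀}}` is ANTITONE on `(0,∞)` — stated without division as `f(y)·x^{d_{l₀}} ≤ f(x)·y^{d_{l₀}}` for
`0 < x ≤ y` — and STRICTLY antitone as soon as some letter off the coupled exponent is non-zero.  Consequences: «passed» persists
forward and «ahead» persists backward (`f(x) < 0 < x < y ⇒ f(y) < 0`), so along `(0,∞)` every row switches from ahead to passed at most
once and the windows of the interaction law (✓ `exists_passed_and_ahead_of_eulerNumeratorK_zero`, companion file `…SplitSignedK`) are the
intervals between consecutive row zeros.

* ★ `splitSigned_row_cross_le` — `0 < x ≤ y ⇒ f(y)·x^{d_{l₀}} ≤ f(x)·y^{d_{l₀}}`;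
* ★ `splitSigned_row_cross_lt` — strict for `x < y` when some letter off the coupled exponent is non-zero;
* `splitSigned_passed_persist` / `splitSigned_ahead_persist` — `f(x) < 0`, `x ≤ y` ⇒ `f(y) < 0`; `0 < f(y)`, `x ≤ y` ⇒ `0 < f(x)`;
* `splitSigned_nonpos_persist` / `splitSigned_nonneg_persist` — the weak forms.

HONEST FRAMING: per-row sign bookkeeping for the every-`K` interior-coupling sector of the research stubs `stub_polyLaw` / `stub_eulerBoundK3`;
closes NO stub by name; NOT `OneChangeFloorK3`, `EulerBoundK3`, `ClassRowK3Linear`, `PPOPolyLaw`, `ProductPlusOneMDR`, `MatrixDescartes`;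
`VP ≠ VNP` is NOT proved and nothing here bears on it.  No definitions, no named facts, no sorry; Mathlib + ✓ `…LetterVariance` (`eval_fewnomial`).

[folklore] Elementary; no citation needed.
-/

set_option linter.dupNamespace false

namespace Summit.ValiantsHypothesis.ValiantsHypothesis.Theorems.LacunarySymmetroidMatrixDescartes

namespace ProductPlusOne

open Polynomial Finset
open scoped BigOperators

/-- The cross term of one letter: for `0 < x ≤ y`, `b·(y^e·x^N − x^e·y^N) ≤ 0` when (`e < N`, `b ≥ 0`) or (`N < e`, `b ≤ 0`)
or `e = N`. [folklore] -/
theorem letter_cross_nonpos (b : ℝ) (e N : ℕ) (hlow : e < N → 0 ≤ b) (hup : N < e → b ≤ 0) {x y : ℝ} (hx : 0 < x)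
    (hxy : x ≤ y) : b * (y ^ e * x ^ N - x ^ e * y ^ N) ≤ 0 := by
  have hy : 0 < y := hx.trans_le hxy
  rcases lt_trichotomy e N with h | h | h
  · -- `e < N`: `y^e x^N − x^e y^N = x^e y^e (x^{N−e} − y^{N−e}) ≤ 0`
    obtain ⟨g, rfl⟩ : ∃ g, N = e + g := ⟨N - e, by omega⟩
    have hg : x ^ g ≤ y ^ g := pow_le_pow_left₀ hx.le hxy g
    have hfac : y ^ e * x ^ (e + g) - x ^ e * y ^ (e + g) = x ^ e * y ^ e * (x ^ g - y ^ g) := by ring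
    rw [hfac]
    have h1 : x ^ e * y ^ e * (x ^ g - y ^ g) ≤ 0 :=
      mul_nonpos_of_nonneg_of_nonpos (mul_nonneg (pow_nonneg hx.le _) (pow_nonneg hy.le _)) (by linarith)
    exact mul_nonpos_of_nonneg_of_nonpos (hlow h) h1
  · subst h; rw [mul_comm (y ^ e), sub_self, mul_zero]
  · obtain ⟨g, rfl⟩ : ∃ g, e = N + g := ⟨e - N, by omega⟩
    have hg : x ^ g ≤ y ^ g := pow_le_pow_left₀ hx.le hxy g
    have hfac : y ^ (N + g) * x ^ N - x ^ (N + g) * y ^ N = x ^ N * y ^ N * (y ^ g - x ^ g) := by ring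
    rw [hfac]
    have h1 : 0 ≤ x ^ N * y ^ N * (y ^ g - x ^ g) :=
      mul_nonneg (mul_nonneg (pow_nonneg hx.le _) (pow_nonneg hy.le _)) (by linarith)
    exact mul_nonpos_of_nonpos_of_nonneg (hup h) h1

/-- Strict cross term: `0 < x < y`, `e ≠ N`, `b ≠ 0` with the split sign ⇒ `b·(y^e·x^N − x^e·y^N) < 0`. [folklore] -/
theorem letter_cross_neg (b : ℝ) (e N : ℕ) (hlow : e < N → 0 ≤ b) (hup : N < e → b ≤ 0) (he : e ≠ N) (hb : b ≠ 0)
    {x y : ℝ} (hx : 0 < x) (hxy : x < y) : b * (y ^ e * x ^ N - x ^ e * y ^ N) < 0 := by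
  have hy : 0 < y := hx.trans hxy
  rcases lt_or_gt_of_ne he with h | h
  · obtain ⟨g, rfl⟩ : ∃ g, N = e + g := ⟨N - e, by omega⟩
    have hg0 : g ≠ 0 := by omega
    have hg : x ^ g < y ^ g := pow_lt_pow_left₀ hxy hx.le hg0
    have hfac : y ^ e * x ^ (e + g) - x ^ e * y ^ (e + g) = x ^ e * y ^ e * (x ^ g - y ^ g) := by ring
    rw [hfac]
    have h1 : x ^ e * y ^ e * (x ^ g - y ^ g) < 0 :=
      mul_neg_of_pos_of_neg (mul_pos (pow_pos hx _) (pow_pos hy _)) (by linarith)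
    exact mul_neg_of_pos_of_neg (lt_of_le_of_ne (hlow h) (Ne.symm hb)) h1
  · obtain ⟨g, rfl⟩ : ∃ g, e = N + g := ⟨e - N, by omega⟩
    have hg0 : g ≠ 0 := by omega
    have hg : x ^ g < y ^ g := pow_lt_pow_left₀ hxy hx.le hg0
    have hfac : y ^ (N + g) * x ^ N - x ^ (N + g) * y ^ N = x ^ N * y ^ N * (y ^ g - x ^ g) := by ring
    rw [hfac]
    have h1 : 0 < x ^ N * y ^ N * (y ^ g - x ^ g) :=
      mul_pos (mul_pos (pow_pos hx _) (pow_pos hy _)) (by linarith)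
    exact mul_neg_of_neg_of_pos (lt_of_le_of_ne (hup h) hb) h1

/-- ★ **The reduced row of a split-signed row is antitone** (every `K`, any support): letters below the coupled exponent `≥ 0`, above
`≤ 0`, `0 < x ≤ y` ⇒ `f(y)·x^{d_{l₀}} ≤ f(x)·y^{d_{l₀}}` (i.e. `f(y)/y^{d_{l₀}} ≤ f(x)/x^{d_{l₀}}`). [this file's theorem] -/
theorem splitSigned_row_cross_le {K : ℕ} (d : Fin K → ℕ) (b : Fin K → ℝ) (l₀ : Fin K)
    (hlow : ∀ l, d l < d l₀ → 0 ≤ b l) (hup : ∀ l, d l₀ < d l → b l ≤ 0) {x y : ℝ} (hx : 0 < x) (hxy : x ≤ y) :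
    (∑ l, C (b l) * X ^ (d l) : ℝ[X]).eval y * x ^ (d l₀) ≤ (∑ l, C (b l) * X ^ (d l) : ℝ[X]).eval x * y ^ (d l₀) := by
  rw [eval_fewnomial, eval_fewnomial, ← sub_nonpos, Finset.sum_mul, Finset.sum_mul, ← Finset.sum_sub_distrib]
  refine Finset.sum_nonpos fun l _ => ?_
  have h := letter_cross_nonpos (b l) (d l) (d l₀) (hlow l) (hup l) hx hxy
  have e : b l * y ^ d l * x ^ d l₀ - b l * x ^ d l * y ^ d l₀ = b l * (y ^ d l * x ^ d l₀ - x ^ d l * y ^ d l₀) := by ring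
  rw [e]; exact h

/-- ★ **Strictly antitone** when some letter off the coupled exponent is non-zero: `0 < x < y` ⇒
`f(y)·x^{d_{l₀}} < f(x)·y^{d_{l₀}}`. [this file's theorem] -/
theorem splitSigned_row_cross_lt {K : ℕ} (d : Fin K → ℕ) (b : Fin K → ℝ) (l₀ : Fin K)
    (hlow : ∀ l, d l < d l₀ → 0 ≤ b l) (hup : ∀ l, d l₀ < d l → b l ≤ 0) (hnd : ∃ l, d l ≠ d l₀ ∧ b l ≠ 0)
    {x y : ℝ} (hx : 0 < x) (hxy : x < y) :
    (∑ l, C (b l) * X ^ (d l) : ℝ[X]).eval y * x ^ (d l₀) < (∑ l, C (b l) * X ^ (d l) : ℝ[X]).eval x * y ^ (d l₀) := by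
  obtain ⟨l₁, hl₁, hb₁⟩ := hnd
  rw [eval_fewnomial, eval_fewnomial, ← sub_neg, Finset.sum_mul, Finset.sum_mul, ← Finset.sum_sub_distrib]
  have hterm : ∀ l ∈ (Finset.univ : Finset (Fin K)), b l * y ^ d l * x ^ d l₀ - b l * x ^ d l * y ^ d l₀ ≤ 0 := by
    intro l _
    have h := letter_cross_nonpos (b l) (d l) (d l₀) (hlow l) (hup l) hx hxy.le
    have e : b l * y ^ d l * x ^ d l₀ - b l * x ^ d l * y ^ d l₀ = b l * (y ^ d l * x ^ d l₀ - x ^ d l * y ^ d l₀) := by ring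
    rw [e]; exact h
  have hstrict : b l₁ * y ^ d l₁ * x ^ d l₀ - b l₁ * x ^ d l₁ * y ^ d l₀ < 0 := by
    have h := letter_cross_neg (b l₁) (d l₁) (d l₀) (hlow l₁) (hup l₁) hl₁ hb₁ hx hxy
    have e : b l₁ * y ^ d l₁ * x ^ d l₀ - b l₁ * x ^ d l₁ * y ^ d l₀ = b l₁ * (y ^ d l₁ * x ^ d l₀ - x ^ d l₁ * y ^ d l₀) := by
      ring
    rw [e]; exact h
  rw [← Finset.add_sum_erase _ _ (Finset.mem_univ l₁)]
  calc _ < 0 + 0 := add_lt_add_of_lt_of_le hstrict (Finset.sum_nonpos fun l _ => hterm l (Finset.mem_univ l))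
    _ = 0 := add_zero 0

/-- **Passed persists forward**: `f(x) < 0`, `0 < x ≤ y` ⇒ `f(y) < 0`. [this file's theorem] -/
theorem splitSigned_passed_persist {K : ℕ} (d : Fin K → ℕ) (b : Fin K → ℝ) (l₀ : Fin K)
    (hlow : ∀ l, d l < d l₀ → 0 ≤ b l) (hup : ∀ l, d l₀ < d l → b l ≤ 0) {x y : ℝ} (hx : 0 < x) (hxy : x ≤ y)
    (hfx : (∑ l, C (b l) * X ^ (d l) : ℝ[X]).eval x < 0) :
    (∑ l, C (b l) * X ^ (d l) : ℝ[X]).eval y < 0 := by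
  have hy : 0 < y := hx.trans_le hxy
  have h := splitSigned_row_cross_le d b l₀ hlow hup hx hxy
  have h1 : (∑ l, C (b l) * X ^ (d l) : ℝ[X]).eval x * y ^ (d l₀) < 0 := mul_neg_of_neg_of_pos hfx (pow_pos hy _)
  by_contra hge
  push Not at hge
  have h2 : 0 ≤ (∑ l, C (b l) * X ^ (d l) : ℝ[X]).eval y * x ^ (d l₀) := mul_nonneg hge (pow_nonneg hx.le _)
  linarith

/-- **Ahead persists backward**: `0 < f(y)`, `0 < x ≤ y` ⇒ `0 < f(x)`. [this file's theorem] -/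
theorem splitSigned_ahead_persist {K : ℕ} (d : Fin K → ℕ) (b : Fin K → ℝ) (l₀ : Fin K)
    (hlow : ∀ l, d l < d l₀ → 0 ≤ b l) (hup : ∀ l, d l₀ < d l → b l ≤ 0) {x y : ℝ} (hx : 0 < x) (hxy : x ≤ y)
    (hfy : 0 < (∑ l, C (b l) * X ^ (d l) : ℝ[X]).eval y) :
    0 < (∑ l, C (b l) * X ^ (d l) : ℝ[X]).eval x := by
  have hy : 0 < y := hx.trans_le hxy
  have h := splitSigned_row_cross_le d b l₀ hlow hup hx hxy
  have h1 : 0 < (∑ l, C (b l) * X ^ (d l) : ℝ[X]).eval y * x ^ (d l₀) := mul_pos hfy (pow_pos hx _)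
  by_contra hle
  push Not at hle
  have h2 : (∑ l, C (b l) * X ^ (d l) : ℝ[X]).eval x * y ^ (d l₀) ≤ 0 := mul_nonpos_of_nonpos_of_nonneg hle (pow_nonneg hy.le _)
  linarith

/-- Weak form: `f(x) ≤ 0`, `0 < x ≤ y` ⇒ `f(y) ≤ 0`. [this file's theorem] -/
theorem splitSigned_nonpos_persist {K : ℕ} (d : Fin K → ℕ) (b : Fin K → ℝ) (l₀ : Fin K)
    (hlow : ∀ l, d l < d l₀ → 0 ≤ b l) (hup : ∀ l, d l₀ < d l → b l ≤ 0) {x y : ℝ} (hx : 0 < x) (hxy : x ≤ y)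
    (hfx : (∑ l, C (b l) * X ^ (d l) : ℝ[X]).eval x ≤ 0) :
    (∑ l, C (b l) * X ^ (d l) : ℝ[X]).eval y ≤ 0 := by
  by_contra hpos
  push Not at hpos
  have := splitSigned_ahead_persist d b l₀ hlow hup hx hxy hpos
  linarith

/-- Weak form: `0 ≤ f(y)`, `0 < x ≤ y` ⇒ `0 ≤ f(x)`. [this file's theorem] -/
theorem splitSigned_nonneg_persist {K : ℕ} (d : Fin K → ℕ) (b : Fin K → ℝ) (l₀ : Fin K)
    (hlow : ∀ l, d l < d l₀ → 0 ≤ b l) (hup : ∀ l, d l₀ < d l → b l ≤ 0) {x y : ℝ} (hx : 0 < x) (hxy : x ≤ y)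
    (hfy : 0 ≤ (∑ l, C (b l) * X ^ (d l) : ℝ[X]).eval y) :
    0 ≤ (∑ l, C (b l) * X ^ (d l) : ℝ[X]).eval x := by
  by_contra hneg
  push Not at hneg
  have := splitSigned_passed_persist d b l₀ hlow hup hx hxy hneg
  linarith

end ProductPlusOne

end Summit.ValiantsHypothesis.ValiantsHypothesis.Theorems.LacunarySymmetroidMatrixDescartes
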